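import Summits.Ventures.PercRepro.S1ChainCq
import Summits.Ventures.PercRepro.S1Lever

/-!
# PercRepro — THE CAPS ON RESTRICTIONS AND THE NULLITY OF A PROPER SUBSET (p2, gen 23; SUBCLAIM-S1 §6.8 (vi))

Service lemmas for the joint caps of rows 9–10. Since the `e`-free partitions pass to every restriction
(`hfree_restrict`), every cap of the tree applies INSIDE any `S ⊆ E` with the nullity `ν(S)` of `S`: the four- and
five-circuits inside `S` number `≤ avgChain16 (ν S)`, `≤ avgChain5b (ν S)`; when `S` is a union of circuits of `M`
the restriction `M ↾ S` is coloop-free and the last averaging step may be taken at `|S|` points (the levers of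
S1Lever on `M ↾ S`). And on a coloop-free core every PROPER subset has nullity `≤ d − 1`: `ν(S) = ν(E)` would make
every point outside `S` a coloop.

* `ncard_fourCircuits_subset_le_avgChain16`, `ncard_fiveCircuits_subset_le_avgChain5b` — the caps inside `S`;
* `coloops_restrict_eq_empty_of_circuits` — a union of circuits is a coloop-free restriction;
* `ncard_triangles_subset_le_lever`, `ncard_fourCircuits_subset_le_lever`, `ncard_fiveCircuits_subset_le_lever` —
  the levers inside a union of circuits;
* **`nullity_add_one_le_of_ssubset_of_coloops_empty`** — `ν(S) + 1 ≤ d` for `S ⊊ E` on a coloop-free core.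
Axioms: standard.
-/

open scoped Matroid

namespace PercRepro

namespace S1

open Set

variable {α : Type}

/-- The four-circuits inside `S ⊆ E` number at most `avgChain16 (ν S)`. -/
theorem ncard_fourCircuits_subset_le_avgChain16 (M : Matroid α) [M.Finite]
    (hfree : ∀ e ∈ M.E, ∃ A ⊆ M.E \ {e}, e ∉ M.closure A ∧ e ∉ M.closure ((M.E \ {e}) \ A))
    {S : Set α} (hS : S ⊆ M.E) {ν : ℕ} (hν : S.encard = M.eRk S + ν) :
    {C : Set α | M.IsCircuit C ∧ C.ncard = 4 ∧ C ⊆ S}.ncard ≤ ThmN.avgChain16 ν := by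
  haveI : (M ↾ S).Finite := M.restrict_finite (M.ground_finite.subset hS)
  have hd : (M ↾ S).E.encard = (M ↾ S).eRank + ν := by
    rw [Matroid.restrict_ground_eq, Matroid.eRank_restrict]; exact hν
  have h := ThmN.ncard_fourCircuits_le_avgChain16 ν (M ↾ S) (hfree_restrict M hfree hS) hd
  have heq : {C : Set α | (M ↾ S).IsCircuit C ∧ C.ncard = 4} =
      {C : Set α | M.IsCircuit C ∧ C.ncard = 4 ∧ C ⊆ S} := by
    ext C
    simp only [Set.mem_setOf_eq, Matroid.restrict_isCircuit_iff hS]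
    tauto
  rwa [heq] at h

/-- The five-circuits inside `S ⊆ E` number at most `avgChain5b (ν S)`. -/
theorem ncard_fiveCircuits_subset_le_avgChain5b (M : Matroid α) [M.Finite]
    (hfree : ∀ e ∈ M.E, ∃ A ⊆ M.E \ {e}, e ∉ M.closure A ∧ e ∉ M.closure ((M.E \ {e}) \ A))
    {S : Set α} (hS : S ⊆ M.E) {ν : ℕ} (hν : S.encard = M.eRk S + ν) :
    {C : Set α | M.IsCircuit C ∧ C.ncard = 5 ∧ C ⊆ S}.ncard ≤ avgChain5b ν := by
  haveI : (M ↾ S).Finite := M.restrict_finite (M.ground_finite.subset hS)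
  have hd : (M ↾ S).E.encard = (M ↾ S).eRank + ν := by
    rw [Matroid.restrict_ground_eq, Matroid.eRank_restrict]; exact hν
  have h := ncard_fiveCircuits_le_avgChain5b ν (M ↾ S) (hfree_restrict M hfree hS) hd
  have heq : {C : Set α | (M ↾ S).IsCircuit C ∧ C.ncard = 5} =
      {C : Set α | M.IsCircuit C ∧ C.ncard = 5 ∧ C ⊆ S} := by
    ext C
    simp only [Set.mem_setOf_eq, Matroid.restrict_isCircuit_iff hS]
    tauto
  rwa [heq] at h

/-- **A union of circuits is a coloop-free restriction**: if every point of `S ⊆ E` lies on a circuit of `M` inside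
`S`, then `M ↾ S` has no coloops. -/
theorem coloops_restrict_eq_empty_of_circuits (M : Matroid α) {S : Set α} (hS : S ⊆ M.E)
    (hcov : ∀ x ∈ S, ∃ C, M.IsCircuit C ∧ C ⊆ S ∧ x ∈ C) : (M ↾ S).coloops = ∅ := by
  rw [Set.eq_empty_iff_forall_notMem]
  intro x hx
  have hxS : x ∈ S := by
    have := (M ↾ S).coloops_subset_ground hx
    rwa [Matroid.restrict_ground_eq] at this
  obtain ⟨C, hC, hCS, hxC⟩ := hcov x hxS
  have hC' : (M ↾ S).IsCircuit C := (Matroid.restrict_isCircuit_iff hS).2 ⟨hC, hCS⟩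
  exact hC'.not_isColoop_of_mem hxC ((Matroid.isColoop_iff_mem_coloops).2 hx)

/-- The triangle lever inside a union of circuits: `#{T ⊆ S} ≤ ⌊|S|·cq3 (ν − 1)/(|S| − 3)⌋` when `ν(S) = ν ≥ 1` and
every point of `S` lies on a circuit inside `S`. -/
theorem ncard_triangles_subset_le_lever (M : Matroid α) [M.Finite]
    (hfree : ∀ e ∈ M.E, ∃ A ⊆ M.E \ {e}, e ∉ M.closure A ∧ e ∉ M.closure ((M.E \ {e}) \ A))
    {S : Set α} (hS : S ⊆ M.E) (hcov : ∀ x ∈ S, ∃ C, M.IsCircuit C ∧ C ⊆ S ∧ x ∈ C)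
    {ν : ℕ} (hν : S.encard = M.eRk S + ((ν + 1 : ℕ) : ℕ∞)) (h3 : 3 < S.ncard) :
    {C : Set α | M.IsCircuit C ∧ C.ncard = 3 ∧ C ⊆ S}.ncard ≤ S.ncard * TriangleCap.cq3 ν / (S.ncard - 3) := by
  haveI : (M ↾ S).Finite := M.restrict_finite (M.ground_finite.subset hS)
  have hd : (M ↾ S).E.encard = (M ↾ S).eRank + ((ν + 1 : ℕ) : ℕ∞) := by
    rw [Matroid.restrict_ground_eq, Matroid.eRank_restrict]; exact hν
  have hn : (M ↾ S).E.ncard = S.ncard := by rw [Matroid.restrict_ground_eq]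
  have h := ncard_triangles_le_of_coloopFree (M ↾ S) (hfree_restrict M hfree hS) hd
    (coloops_restrict_eq_empty_of_circuits M hS hcov) hn h3
  have heq : {C : Set α | (M ↾ S).IsCircuit C ∧ C.ncard = 3} =
      {C : Set α | M.IsCircuit C ∧ C.ncard = 3 ∧ C ⊆ S} := by
    ext C
    simp only [Set.mem_setOf_eq, Matroid.restrict_isCircuit_iff hS]
    tauto
  rwa [heq] at h

/-- The four-circuit lever inside a union of circuits. -/
theorem ncard_fourCircuits_subset_le_lever (M : Matroid α) [M.Finite]
    (hfree : ∀ e ∈ M.E, ∃ A ⊆ M.E \ {e}, e ∉ M.closure A ∧ e ∉ M.closure ((M.E \ {e}) \ A))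
    {S : Set α} (hS : S ⊆ M.E) (hcov : ∀ x ∈ S, ∃ C, M.IsCircuit C ∧ C ⊆ S ∧ x ∈ C)
    {ν : ℕ} (hν : S.encard = M.eRk S + (ν + 1)) (h4 : 4 < S.ncard) :
    {C : Set α | M.IsCircuit C ∧ C.ncard = 4 ∧ C ⊆ S}.ncard ≤ S.ncard * ThmN.avgChain16 ν / (S.ncard - 4) := by
  haveI : (M ↾ S).Finite := M.restrict_finite (M.ground_finite.subset hS)
  have hd : (M ↾ S).E.encard = (M ↾ S).eRank + (ν + 1) := by
    rw [Matroid.restrict_ground_eq, Matroid.eRank_restrict]; exact hν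
  have hn : (M ↾ S).E.ncard = S.ncard := by rw [Matroid.restrict_ground_eq]
  have h := ncard_fourCircuits_le_of_coloopFree (M ↾ S) (hfree_restrict M hfree hS) hd
    (coloops_restrict_eq_empty_of_circuits M hS hcov) hn h4
  have heq : {C : Set α | (M ↾ S).IsCircuit C ∧ C.ncard = 4} =
      {C : Set α | M.IsCircuit C ∧ C.ncard = 4 ∧ C ⊆ S} := by
    ext C
    simp only [Set.mem_setOf_eq, Matroid.restrict_isCircuit_iff hS]
    tauto
  rwa [heq] at h

/-- The five-circuit lever inside a union of circuits. -/
theorem ncard_fiveCircuits_subset_le_lever (M : Matroid α) [M.Finite]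
    (hfree : ∀ e ∈ M.E, ∃ A ⊆ M.E \ {e}, e ∉ M.closure A ∧ e ∉ M.closure ((M.E \ {e}) \ A))
    {S : Set α} (hS : S ⊆ M.E) (hcov : ∀ x ∈ S, ∃ C, M.IsCircuit C ∧ C ⊆ S ∧ x ∈ C)
    {ν : ℕ} (hν : S.encard = M.eRk S + (ν + 1)) (h5 : 5 < S.ncard) :
    {C : Set α | M.IsCircuit C ∧ C.ncard = 5 ∧ C ⊆ S}.ncard ≤ S.ncard * avgChain5b ν / (S.ncard - 5) := by
  haveI : (M ↾ S).Finite := M.restrict_finite (M.ground_finite.subset hS)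
  have hd : (M ↾ S).E.encard = (M ↾ S).eRank + (ν + 1) := by
    rw [Matroid.restrict_ground_eq, Matroid.eRank_restrict]; exact hν
  have hn : (M ↾ S).E.ncard = S.ncard := by rw [Matroid.restrict_ground_eq]
  have h := ncard_fiveCircuits_le_of_coloopFree (M ↾ S) (hfree_restrict M hfree hS) hd
    (coloops_restrict_eq_empty_of_circuits M hS hcov) hn h5
  have heq : {C : Set α | (M ↾ S).IsCircuit C ∧ C.ncard = 5} =
      {C : Set α | M.IsCircuit C ∧ C.ncard = 5 ∧ C ⊆ S} := by
    ext C
    simp only [Set.mem_setOf_eq, Matroid.restrict_isCircuit_iff hS]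
    tauto
  rwa [heq] at h

/-- **A proper subset of a coloop-free core has nullity `≤ d − 1`**: for `S ⊊ E` with `r(S) + r ≤ |S|` (nullity
`≥ r`) and `|E| = r(E) + d`, `r + 1 ≤ d` — a point `x ∉ S` is not a coloop, so `r(E ∖ x) = r(E)` and
`ν(S) ≤ ν(E ∖ x) = d − 1`. -/
theorem nullity_add_one_le_of_ssubset_of_coloops_empty (M : Matroid α) [M.Finite] (hcol : M.coloops = ∅)
    {d : ℕ} (hd : M.E.encard = M.eRank + d) {S : Set α} (hS : S ⊆ M.E) (hne : S ≠ M.E) {r : ℕ}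
    (hν : M.eRk S + (r : ℕ∞) ≤ (S.ncard : ℕ∞)) : r + 1 ≤ d := by
  have hEfin : M.E.Finite := M.ground_finite
  obtain ⟨x, hxE, hxS⟩ : ∃ x ∈ M.E, x ∉ S := by
    by_contra h
    push Not at h
    exact hne (Set.Subset.antisymm hS h)
  -- `x` is not a coloop: `x ∈ cl (E ∖ x)`, so `r(E ∖ x) = r(E)`
  have hnc : ¬ M.IsColoop x := by
    rw [Matroid.isColoop_iff_mem_coloops, hcol]; exact Set.notMem_empty x
  rw [Matroid.isColoop_iff_notMem_closure_compl hxE, not_not] at hnc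
  have hrEx : M.eRk (M.E \ {x}) = M.eRank := by
    rw [← M.eRk_ground]
    have h2 : M.E ⊆ M.closure (M.E \ {x}) := by
      intro y hy
      by_cases hyx : y = x
      · rw [hyx]; exact hnc
      · exact M.subset_closure (M.E \ {x}) (by intro z hz; exact hz.1) ⟨hy, hyx⟩
    apply le_antisymm
    · exact M.eRk_mono Set.sdiff_subset
    · calc M.eRk M.E ≤ M.eRk (M.closure (M.E \ {x})) := M.eRk_mono h2
        _ = M.eRk (M.E \ {x}) := M.eRk_closure_eq _
  -- `S ⊆ E ∖ x`, and the nullity is monotone: `r(E ∖ x) ≤ r(S) + |E ∖ x ∖ S|`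
  have hSx : S ⊆ M.E \ {x} := fun y hy => ⟨hS hy, fun h => hxS (h ▸ hy)⟩
  have hsub := M.eRk_union_le_eRk_add_encard S ((M.E \ {x}) \ S)
  rw [Set.union_sdiff_cancel hSx, hrEx] at hsub
  -- to naturals
  have hSfin : S.Finite := hEfin.subset hS
  have hrS : M.eRk S ≠ ⊤ := ((M.eRk_le_encard S).trans_lt hSfin.encard_lt_top).ne
  obtain ⟨a, ha⟩ := ENat.ne_top_iff_exists.1 hrS
  have hrE : M.eRank ≠ ⊤ := by
    rw [← M.eRk_ground]
    exact ((M.eRk_le_encard M.E).trans_lt hEfin.encard_lt_top).ne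
  obtain ⟨b, hb⟩ := ENat.ne_top_iff_exists.1 hrE
  have hcompl : ((M.E \ {x}) \ S).ncard + S.ncard + 1 = M.E.ncard := by
    have h1 : ((M.E \ {x}) \ S).ncard + S.ncard = (M.E \ {x}).ncard :=
      Set.ncard_sdiff_add_ncard_of_subset hSx (hEfin.subset Set.sdiff_subset)
    have h2 : (M.E \ {x}).ncard + 1 = M.E.ncard := by
      rw [Set.ncard_sdiff_singleton_add_one hxE hEfin]
    omega
  rw [← ha, ← hb, ← ((hEfin.subset Set.sdiff_subset).subset Set.sdiff_subset).cast_ncard_eq] at hsub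
  rw [← ha] at hν
  rw [← hb, ← hEfin.cast_ncard_eq] at hd
  have hsub' : b ≤ a + ((M.E \ {x}) \ S).ncard := by exact_mod_cast hsub
  have hν' : a + r ≤ S.ncard := by exact_mod_cast hν
  have hd' : M.E.ncard = b + d := by exact_mod_cast hd
  omega

end S1

end PercRepro
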